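import Literature.NumberTheory.LFunctions.RodgersTaoLocationUniformProofs
import HarnessLib

/-!
# Rodgers–Tao 2020, Corollary 3.3 (51) `x_j(t) ≍ j/log₊ ξ_j` uniformly in `t`, WITH CONTENT

Trunk T-ANT (`Literature/NumberTheory/LFunctions`). PROOFS ONLY: no definition, no named fact.
LINE 1 — LABEL: RH-FREE literature (Rodgers–Tao 2020, §3); bears_on LADDER-RH N-C/N-P
(COLUMN 3, DBN). WHAT THIS IS NOT: every statement here concerns `H_t` at times `t` lying above a
real-rooted time — vacuous for `ζ` at `t < 0` (the tree proves `Λ ≥ 0`, `rodgers_tao_holds`) and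
the Riemann hypothesis' business at `t = 0`; proving the printed chain WITH CONTENT (instead of ex
falso from `Λ ≥ 0`) certifies the source's derivation, it does not move RH. Nothing in this file
bears on the truth of RH.

## What is proved

B. Rodgers, T. Tao, *The de Bruijn–Newman constant is non-negative*, Forum Math. Pi 8 (2020) e6,
Corollary 10 (= arXiv:1801.05914v4 Corollary 3.3), eq. (51), p. 23: «Let `Λ < t ⩽ 0`. Then …
in particular `x_j(t) ≍ j/log₊ ξ_j ≍ j/log₊ j` for all `j ≥ 1`.» The printed deduction (p.22 for
`t = 0`: «from (43) and the fact that `x_1(0) > 0`»; p.23: «Repeating the previous analysis») needs,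
for constants ABSOLUTE in `t` as §1.2 stipulates, a floor `x_1(t) ≥ x₀ > 0` UNIFORM in `t`; the
source does not spell this out. It is supplied here by an elementary estimate on the defining
integral (1): for `−T₀ ≤ t ≤ 0` and real `x`,
`H_t(x) = ∫₀^∞ e^{tu²}Φ(u)cos(xu) du ≥ H_{−T₀}(0) − (x²/2)∫₀^∞ Φ(u)e^{2u} du`
(`cos θ ≥ 1 − θ²/2`, `u² ≤ e^{2u}`, `Φ > 0`), which is positive for `|x| ≤ x₀(T₀)`.

* `RodgersTaoOrderUniform.exists_pos_le_deBruijnZero (T₀)` — `∃ x₀ > 0, ∀ t ∈ [−T₀, 0]` above a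
  real-rooted time, `∀ j ≥ 1, x₀ ≤ x_j(t)`.
* `RodgersTao2020.cor33_order_of_location_uniform` — rt-t2's RH-free schema
  `cor33_order_of_location` ((50) at `t` ⟹ (51) at `t`, `RodgersTaoRiemannVonMangoldtProofs.lean`,
  whose lower constant depends on `x_1(t)`) with the constants quantified BEFORE `t`: given `B` and a
  floor `x₀ > 0`, `∃ 0 < c ≤ C, ∀ t` above a real-rooted time with `x₀ ≤ x_1(t)` and (50) with `B`,
  (51) with `c, C`. (t2's proof verbatim, `x_1(t) ↦ x₀`.)
* `RodgersTao2020.cor33_order_inner (T₀)` — `∃ 0 < c ≤ C, ∀ t ∈ [−T₀, 0]` above a real-rooted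
  time, `∀ j ≥ 1, c·j/log₊ ξ_j ≤ x_j(t) ≤ C·j/log₊ ξ_j`: from `cor33_location_inner` ((50) with one
  constant on the interval, `RodgersTaoLocationUniformProofs.lean`, itself from Theorem 3.2 (48)
  `thm32_bigO_inner`) and the uniform floor.
* `RodgersTao2020.cor33_order_content : cor33_order` — **(51) AS PRINTED, WITH CONTENT**: by
  Newman's theorem (`Λ > −∞`: `bddBelow_setOf_hasOnlyRealZeros_holds`) every time above a
  real-rooted time lies in one window `[L, 0]`, so `cor33_order_inner (−L)` gives the as-printed
  `sInf`-free statement with ONE pair of absolute constants. So far the tree discharged this fact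
  only EX FALSO (`cor33_order_holds`, from `Λ ≥ 0`); the present proof makes no use of `Λ ≥ 0`.
  (Its hypothesis «`∃ t₁ < t`, `H_{t₁}` real-rooted, `t ≤ 0`» remains unsatisfiable for `ζ`.)

With `RodgersTaoZeroCountingProofs.lean` ((48)) and `RodgersTaoLocationUniformProofs.lean` ((50))
this completes the `O(·)`-half of Theorem 3.2 / Corollary 3.3 with content; not treated: the
`o(·)` statements (49)/(52) (`thm32_littleO`, `cor33_gaps` — the normal-families step) and hence
Lemma 20 (`rodgers_tao_renormHamiltonian_decay_of_cor33` also consumes (52)). Lemma 19 as printed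
follows with content in one line from rt-t1's landed reduction —
`rodgers_tao_truncHamiltonian_expansion_of_cor33_location RodgersTao2020.cor33_location_content` —
and is not re-declared (its type coincides with the landed `rodgers_tao_truncHamiltonian_expansion_holds`;
dedup rule).

## References

* B. Rodgers, T. Tao, *The de Bruijn–Newman constant is non-negative*, Forum Math. Pi 8 (2020),
  e6 = arXiv:1801.05914: eq. (1) p. 2 (definition of `H_t`), Lemma 8 (i) p. 21, display after (47)
  p. 22, Corollary 10 (51) p. 23. [RodgersTaoFMP2020]
* C. M. Newman, *Fourier transforms with only real zeros*, Proc. AMS 61 (1976), Thm. 3 (`Λ > −∞`).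
  [Newman1976]
-/

noncomputable section

open Complex Set Filter Topology MeasureTheory
open scoped Real

namespace Literature.NumberTheory.LFunctions

namespace RodgersTaoOrderUniform

/-! ## A `t`-uniform lower bound for the real zeros of `H_t` -/

/-- `H_t(x) = ∫₀^∞ e^{tu²} Φ(u) cos(xu) du` for real `x`, as a real integral. [folklore] -/
private theorem deBruijnH_ofReal_eq_integral (t x : ℝ) :
    deBruijnH t x =
      ((∫ u in Ioi (0 : ℝ), Real.exp (t * u ^ 2) * deBruijnPhi u * Real.cos (x * u) : ℝ) : ℂ) := by
  rw [deBruijnH_eq_integral, ← integral_complex_ofReal]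
  refine setIntegral_congr_fun measurableSet_Ioi fun u _ ↦ ?_
  simp only [deBruijnHIntegrand]
  push_cast
  ring

/-- Integrability on `(0, ∞)` of a continuous-on-`[0,∞)` real function dominated there by
`deBruijnHBound T Y`. [folklore] -/
private theorem integrableOn_of_le_deBruijnHBound {f : ℝ → ℝ} (T Y : ℝ)
    (hf : ContinuousOn f (Ici 0)) (hle : ∀ u : ℝ, 0 < u → |f u| ≤ deBruijnHBound T Y u) :
    IntegrableOn f (Ioi 0) := by
  refine (integrableOn_deBruijnHBound T Y).mono'
    ((hf.mono Ioi_subset_Ici_self).aestronglyMeasurable measurableSet_Ioi)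
    (ae_restrict_of_forall_mem measurableSet_Ioi fun u hu ↦ ?_)
  rw [Real.norm_eq_abs]
  exact hle u hu

/-- The integrand `e^{tu²} Φ(u) cos(xu)` is integrable on `(0, ∞)`. [folklore] -/
private theorem integrableOn_cosIntegrand (t x : ℝ) :
    IntegrableOn (fun u : ℝ ↦ Real.exp (t * u ^ 2) * deBruijnPhi u * Real.cos (x * u)) (Ioi 0) := by
  refine integrableOn_of_le_deBruijnHBound t 0 ?_ fun u hu ↦ ?_
  · exact (((by fun_prop : Continuous fun u : ℝ ↦ Real.exp (t * u ^ 2)).continuousOn.mul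
      continuousOn_deBruijnPhi_Ici).mul (by fun_prop : Continuous fun u : ℝ ↦ Real.cos (x * u)).continuousOn)
  · rw [deBruijnHBound, abs_mul, abs_mul, abs_of_pos (Real.exp_pos _), zero_mul, Real.exp_zero,
      mul_one]
    exact mul_le_of_le_one_right (by positivity) (Real.abs_cos_le_one _)

/-- The function `e^{su²} Φ(u)` is integrable on `(0, ∞)`. [folklore] -/
private theorem integrableOn_expIntegrand (s : ℝ) :
    IntegrableOn (fun u : ℝ ↦ Real.exp (s * u ^ 2) * deBruijnPhi u) (Ioi 0) := by
  refine integrableOn_of_le_deBruijnHBound s 0 ?_ fun u hu ↦ ?_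
  · exact (by fun_prop : Continuous fun u : ℝ ↦ Real.exp (s * u ^ 2)).continuousOn.mul
      continuousOn_deBruijnPhi_Ici
  · rw [deBruijnHBound, abs_mul, abs_of_pos (Real.exp_pos _), zero_mul, Real.exp_zero, mul_one]

/-- Pointwise minorant: for `−T₀ ≤ t ≤ 0`, `u > 0` and real `x`,
`e^{tu²} Φ(u) cos(xu) ≥ e^{−T₀u²} Φ(u) − (x²/2)·Φ(u) e^{2u}` (from `cos θ ≥ 1 − θ²/2`,
`u² ≤ e^{2u}`, `Φ > 0`). [folklore] -/
private theorem minorant_le {T₀ t x u : ℝ} (ht : t ∈ Icc (-T₀) 0) (hu : 0 < u) :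
    Real.exp (-T₀ * u ^ 2) * deBruijnPhi u - x ^ 2 / 2 * deBruijnHBound 0 2 u ≤
      Real.exp (t * u ^ 2) * deBruijnPhi u * Real.cos (x * u) := by
  have hΦ : 0 < deBruijnPhi u := deBruijnPhi_pos_of_nonneg hu.le
  have hcos : 1 - (x * u) ^ 2 / 2 ≤ Real.cos (x * u) := Real.one_sub_sq_div_two_le_cos
  have he1 : Real.exp (-T₀ * u ^ 2) ≤ Real.exp (t * u ^ 2) :=
    Real.exp_monotone (by have := ht.1; nlinarith [sq_nonneg u])
  have he2 : Real.exp (t * u ^ 2) ≤ 1 := by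
    rw [← Real.exp_zero]; exact Real.exp_monotone (by have := ht.2; nlinarith [sq_nonneg u])
  have hu2 : u ^ 2 ≤ Real.exp (2 * u) := sq_le_exp_two_mul hu.le
  have hB : deBruijnHBound 0 2 u = deBruijnPhi u * Real.exp (2 * u) := by
    rw [deBruijnHBound, zero_mul, Real.exp_zero, one_mul, abs_of_pos hΦ]
  rw [hB]
  have hE0 : 0 < Real.exp (t * u ^ 2) := Real.exp_pos _
  -- `e^{tu²} Φ u² ≤ Φ e^{2u}`
  have h3 : Real.exp (t * u ^ 2) * deBruijnPhi u * u ^ 2 ≤ deBruijnPhi u * Real.exp (2 * u) := by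
    calc Real.exp (t * u ^ 2) * deBruijnPhi u * u ^ 2 ≤ 1 * deBruijnPhi u * Real.exp (2 * u) := by
          gcongr
      _ = deBruijnPhi u * Real.exp (2 * u) := by ring
  have h4 : Real.exp (t * u ^ 2) * deBruijnPhi u * (1 - (x * u) ^ 2 / 2) ≤
      Real.exp (t * u ^ 2) * deBruijnPhi u * Real.cos (x * u) :=
    mul_le_mul_of_nonneg_left hcos (mul_pos hE0 hΦ).le
  have h5 : Real.exp (-T₀ * u ^ 2) * deBruijnPhi u ≤ Real.exp (t * u ^ 2) * deBruijnPhi u :=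
    mul_le_mul_of_nonneg_right he1 hΦ.le
  have hx2 : 0 ≤ x ^ 2 / 2 := by positivity
  have h6 := mul_le_mul_of_nonneg_left h3 hx2
  calc Real.exp (-T₀ * u ^ 2) * deBruijnPhi u - x ^ 2 / 2 * (deBruijnPhi u * Real.exp (2 * u))
      ≤ Real.exp (t * u ^ 2) * deBruijnPhi u -
          x ^ 2 / 2 * (Real.exp (t * u ^ 2) * deBruijnPhi u * u ^ 2) := by linarith
    _ = Real.exp (t * u ^ 2) * deBruijnPhi u * (1 - (x * u) ^ 2 / 2) := by ring
    _ ≤ Real.exp (t * u ^ 2) * deBruijnPhi u * Real.cos (x * u) := h4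

/-- **Lower bound for `Re H_t(x)`**, uniformly in `t ∈ [−T₀, 0]`:
`Re H_t(x) ≥ H_{−T₀}(0) − (x²/2) ∫₀^∞ Φ(u) e^{2u} du`. [folklore] -/
private theorem re_deBruijnH_ofReal_ge {T₀ t : ℝ} (ht : t ∈ Icc (-T₀) 0) (x : ℝ) :
    (∫ u in Ioi (0 : ℝ), Real.exp (-T₀ * u ^ 2) * deBruijnPhi u) -
        x ^ 2 / 2 * ∫ u in Ioi (0 : ℝ), deBruijnHBound 0 2 u ≤ (deBruijnH t x).re := by
  rw [deBruijnH_ofReal_eq_integral, Complex.ofReal_re, ← integral_const_mul, ← integral_sub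
    (integrableOn_expIntegrand (-T₀)) ((integrableOn_deBruijnHBound 0 2).const_mul _)]
  exact setIntegral_mono_on (((integrableOn_expIntegrand (-T₀))).sub
    ((integrableOn_deBruijnHBound 0 2).const_mul _)) (integrableOn_cosIntegrand t x)
    measurableSet_Ioi fun u hu ↦ minorant_le ht hu

/-- **No real zero of `H_t` near the origin, uniformly in `t ∈ [−T₀, 0]`**: there is `x₀ > 0`
(depending on `T₀` only) with `H_t(x) ≠ 0` for all `t ∈ [−T₀, 0]` and all real `|x| ≤ x₀`.
[folklore] -/
private theorem exists_pos_deBruijnH_ofReal_ne_zero (T₀ : ℝ) :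
    ∃ x₀ : ℝ, 0 < x₀ ∧ ∀ t ∈ Icc (-T₀) 0, ∀ x : ℝ, |x| ≤ x₀ → deBruijnH t x ≠ 0 := by
  set m : ℝ := ∫ u in Ioi (0 : ℝ), Real.exp (-T₀ * u ^ 2) * deBruijnPhi u with hm
  set M : ℝ := ∫ u in Ioi (0 : ℝ), deBruijnHBound 0 2 u with hM
  have hm0 : 0 < m := deBruijnH_apply_zero_pos (-T₀)
  have hM0 : 0 ≤ M := setIntegral_nonneg measurableSet_Ioi fun u _ ↦ deBruijnHBound_nonneg 0 2 u
  have hM1 : 0 < M + 1 := by linarith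
  refine ⟨min 1 (m / (M + 1)), lt_min one_pos (div_pos hm0 hM1), fun t ht x hx h0 ↦ ?_⟩
  have hre := re_deBruijnH_ofReal_ge ht x
  rw [h0, Complex.zero_re] at hre
  set x₀ : ℝ := min 1 (m / (M + 1)) with hx₀
  have hx₀1 : x₀ ≤ 1 := min_le_left _ _
  have hx₀2 : x₀ ≤ m / (M + 1) := min_le_right _ _
  have hx₀0 : 0 ≤ x₀ := le_min zero_le_one (div_pos hm0 hM1).le
  have hxx : x ^ 2 ≤ x₀ := by
    have h1 : x ^ 2 ≤ x₀ ^ 2 := by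
      rw [← sq_abs x]; exact pow_le_pow_left₀ (abs_nonneg x) hx 2
    nlinarith
  have hkey : x ^ 2 / 2 * M ≤ m / 2 := by
    have h1 : x ^ 2 / 2 * M ≤ x₀ / 2 * M := by
      have := mul_le_mul_of_nonneg_right hxx hM0; linarith
    have h2 : x₀ / 2 * M ≤ m / (M + 1) / 2 * M := by
      have := mul_le_mul_of_nonneg_right hx₀2 hM0; linarith
    have h3 : m / (M + 1) * M ≤ m := by
      rw [div_mul_eq_mul_div, div_le_iff₀ hM1]; nlinarith
    linarith
  linarith

/-- **`t`-UNIFORM positivity of the zeros `x_j(t)`** (the input «`x_1 > 0`» of the printed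
deduction of (51), FMP p.22 l.−3 / p.23, made uniform in `t`): for every `T₀` there is `x₀ > 0`
such that `x₀ ≤ x_j(t)` for all `t ∈ [−T₀, 0]` above a real-rooted time and all `j ≥ 1`. Proof:
`Re H_t(x) ≥ H_{−T₀}(0) − (x²/2)∫₀^∞ Φ(u)e^{2u} du > 0` for `|x| ≤ x₀` (from `cos θ ≥ 1 − θ²/2`,
`t ≤ 0`, `Φ > 0`), while `x_1(t) ≤ x_j(t)` is a zero of `H_t`.
[cite: RodgersTaoFMP2020, Corollary 10 (= arXiv v4 Corollary 3.3) eq. (51) p.23 (the step «x_1 > 0», uniform form)] -/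
theorem exists_pos_le_deBruijnZero (T₀ : ℝ) :
    ∃ x₀ : ℝ, 0 < x₀ ∧ ∀ t ∈ Icc (-T₀) 0, (∃ t₁ : ℝ, t₁ < t ∧ HasOnlyRealZeros (deBruijnH t₁)) →
      ∀ j : ℕ, 1 ≤ j → x₀ ≤ deBruijnZero t j := by
  obtain ⟨x₀, hx₀, hne⟩ := exists_pos_deBruijnH_ofReal_ne_zero T₀
  refine ⟨x₀, hx₀, fun t ht hΛ j hj ↦ ?_⟩
  have h1 : x₀ ≤ deBruijnZero t 1 := by
    refine le_of_not_gt fun hlt ↦ ?_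
    have hpos : 0 < deBruijnZero t 1 := deBruijnZero_pos hΛ le_rfl
    exact hne t ht (deBruijnZero t 1) (by rw [abs_of_pos hpos]; exact hlt.le)
      (deBruijnH_deBruijnZero hΛ le_rfl)
  exact h1.trans ((strictMono_deBruijnZero hΛ).monotone hj)

end RodgersTaoOrderUniform

namespace RodgersTao2020

/-! ## Corollary 3.3 (51): `x_j(t) ≍ j/log₊ ξ_j` with constants uniform in `t` -/

/-- `log y ≤ 4·y^{1/4}` (`y > 0`), in the form `log y ≤ 4 √(√y)`. [folklore] -/
private theorem log_le_four_mul_sqrt_sqrt {y : ℝ} (hy : 0 < y) :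
    Real.log y ≤ 4 * Real.sqrt (Real.sqrt y) := by
  have h1 : Real.log y = 4 * Real.log (Real.sqrt (Real.sqrt y)) := by
    rw [Real.log_sqrt (Real.sqrt_nonneg _), Real.log_sqrt hy.le]; ring
  have h2 : Real.log (Real.sqrt (Real.sqrt y)) ≤ Real.sqrt (Real.sqrt y) - 1 :=
    Real.log_le_sub_one_of_pos (Real.sqrt_pos.mpr (Real.sqrt_pos.mpr hy))
  linarith

/-- Growth of `log₊²`: `log₊² X ≤ 23 √X` for `X ≥ 2`. [folklore] -/
private theorem logPlus_sq_le_sqrt {X : ℝ} (hX : 2 ≤ X) : logPlus X ^ 2 ≤ 23 * Real.sqrt X := by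
  have hX0 : 0 < X := by linarith
  have hs : logPlus X ≤ 4 * Real.sqrt (Real.sqrt (2 + X)) := by
    rw [logPlus_of_nonneg hX0.le]; exact log_le_four_mul_sqrt_sqrt (by linarith)
  have hL0 : 0 ≤ logPlus X := (logPlus_pos X).le
  have h1 : logPlus X ^ 2 ≤ 16 * Real.sqrt (2 + X) := by
    calc logPlus X ^ 2 ≤ (4 * Real.sqrt (Real.sqrt (2 + X))) ^ 2 := pow_le_pow_left₀ hL0 hs 2
      _ = 16 * Real.sqrt (2 + X) := by rw [mul_pow, Real.sq_sqrt (Real.sqrt_nonneg _)]; norm_num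
  have h2 : Real.sqrt (2 + X) ≤ Real.sqrt 2 * Real.sqrt X := by
    rw [← Real.sqrt_mul (by norm_num : (0 : ℝ) ≤ 2)]
    exact Real.sqrt_le_sqrt (by linarith)
  have h3 : Real.sqrt 2 < 1.42 := by
    rw [Real.sqrt_lt' (by norm_num)]; norm_num
  nlinarith [Real.sqrt_nonneg X, Real.sqrt_nonneg 2]

/-- `log₊² j ≤ 23 j` for real `j ≥ 1`. [folklore] -/
private theorem logPlus_sq_le_mul {j : ℝ} (hj : 1 ≤ j) : logPlus j ^ 2 ≤ 23 * j := by
  rcases le_or_gt 2 j with h2 | h2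
  · have hs : Real.sqrt j ≤ j := by
      have h1 : 1 ≤ Real.sqrt j := Real.one_le_sqrt.mpr hj
      have hss : Real.sqrt j * Real.sqrt j = j := Real.mul_self_sqrt (by linarith)
      nlinarith
    have := logPlus_sq_le_sqrt h2
    linarith
  · have hL : logPlus j ≤ Real.log 4 := by
      rw [logPlus_of_nonneg (by linarith)]
      exact Real.log_le_log (by linarith) (by linarith)
    have h4 : Real.log 4 < 2 := by
      have : Real.log 4 = 2 * Real.log 2 := by
        rw [show (4 : ℝ) = 2 ^ 2 by norm_num, Real.log_pow]; ring
      have := Real.log_two_lt_d9; linarith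
    have hL0 : 0 ≤ logPlus j := (logPlus_pos j).le
    have : logPlus j ^ 2 ≤ 2 ^ 2 := pow_le_pow_left₀ hL0 (by linarith) 2
    linarith

set_option maxHeartbeats 400000 in
/-- **Corollary 3.3, eq. (51), first comparison — RH-FREE schema with constants quantified BEFORE
`t`.** Given `B` and `x₀ > 0` there are `0 < c ≤ C` such that at every time `t` above a
real-rooted time at which the first zero satisfies `x_1(t) ≥ x₀` and the location law (50) holds
with constant `B` (`|x_j(t) − ξ_j| ≤ B log₊ ξ_j`, `j ≥ 1`), one has
`c·j/log₊ ξ_j ≤ x_j(t) ≤ C·j/log₊ ξ_j` for all `j ≥ 1`. This is rt-t2's pointwise-in-`t` schema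
`cor33_order_of_location` (`RodgersTaoRiemannVonMangoldtProofs.lean`) — the printed deduction
«from (43) and the fact that `x_1 > 0`» (FMP p.22, repeated at p.23 for `Λ < t ≤ 0`) — with its
dependence on `x_1(t)` replaced by the uniform floor `x₀`; proof verbatim otherwise
(`c = min(c₀²/2, x₀ log 2/j₁)`, `C = C₀² + 23 B⁺ C₀²`, `j₁ = (46 B⁺ C₀²/c₀²)² + 2`, `c₀, C₀` from
Lemma 3.1 (i′) `lemma31_i_order_holds`). [cite: RodgersTaoFMP2020, Corollary 3.3 = Corollary 10 eq. (51) p.23] -/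
theorem cor33_order_of_location_uniform (B : ℝ) {x₀ : ℝ} (hx₀ : 0 < x₀) :
    ∃ c C : ℝ, 0 < c ∧ c ≤ C ∧
      ∀ t : ℝ, (∃ t₁ : ℝ, t₁ < t ∧ HasOnlyRealZeros (deBruijnH t₁)) → x₀ ≤ deBruijnZero t 1 →
        (∀ j : ℕ, 1 ≤ j →
          |deBruijnZero t j - classicalLocation (j : ℝ)| ≤ B * logPlus (classicalLocation (j : ℝ))) →
        ∀ j : ℕ, 1 ≤ j →
          c * ((j : ℝ) / logPlus (classicalLocation (j : ℝ))) ≤ deBruijnZero t j ∧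
            deBruijnZero t j ≤ C * ((j : ℝ) / logPlus (classicalLocation (j : ℝ))) := by
  obtain ⟨c, C, hc, hcC, hord⟩ := lemma31_i_order_holds
  have hC : 0 < C := lt_of_lt_of_le hc hcC
  set B' : ℝ := max B 0 with hB'
  have hB'0 : 0 ≤ B' := le_max_right _ _
  have hBB' : B ≤ B' := le_max_left _ _
  have hlog2 : 0 < Real.log 2 := Real.log_pos one_lt_two
  obtain ⟨j₁, hj₁⟩ : ∃ j₁ : ℝ, j₁ = (46 * B' * C ^ 2 / c ^ 2) ^ 2 + 2 := ⟨_, rfl⟩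
  have hj₁2 : 2 ≤ j₁ := by rw [hj₁]; nlinarith [sq_nonneg (46 * B' * C ^ 2 / c ^ 2)]
  have hj₁0 : 0 < j₁ := by linarith
  have hc2 : 0 < c ^ 2 / 2 := by positivity
  have hsmallc : 0 < x₀ * Real.log 2 / j₁ := by positivity
  refine ⟨min (c ^ 2 / 2) (x₀ * Real.log 2 / j₁), C ^ 2 + 23 * B' * C ^ 2,
    lt_min hc2 hsmallc, ?_, fun t hΛ hx1 h50 j hj ↦ ?_⟩
  · have h1 : c ^ 2 / 2 ≤ C ^ 2 := by nlinarith [pow_le_pow_left₀ hc.le hcC 2]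
    have h2 : 0 ≤ 23 * B' * C ^ 2 := by positivity
    exact (min_le_left _ _).trans (by linarith)
  have hj1 : (1 : ℝ) ≤ j := by exact_mod_cast hj
  have hj0 : (0 : ℝ) < j := by linarith
  obtain ⟨h1, h2, h3, h4⟩ := hord j hj1
  have hb := h50 j hj
  have hmono : x₀ ≤ deBruijnZero t j := hx1.trans ((strictMono_deBruijnZero hΛ).monotone hj)
  generalize hXdef : deBruijnZero t j = X at hb hmono ⊢
  generalize hξdef : classicalLocation (j : ℝ) = ξ at h1 h2 h3 h4 hb ⊢
  clear hXdef hξdef h50 hord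
  set Lj := logPlus (j : ℝ) with hLj
  set Lξ := logPlus ξ with hLξ
  have hLj0 : 0 < Lj := logPlus_pos _
  have hLξ0 : 0 < Lξ := logPlus_pos _
  have hLξ2 : Real.log 2 ≤ Lξ := log_two_le_logPlus ξ
  have hq0 : 0 < (j : ℝ) / Lξ := div_pos hj0 hLξ0
  -- `ξ_j ≍ j / log₊ ξ_j`
  have hξup : ξ ≤ C ^ 2 * ((j : ℝ) / Lξ) := by
    have : C * ((j : ℝ) / Lj) ≤ C ^ 2 * ((j : ℝ) / Lξ) := by
      rw [show C ^ 2 * ((j : ℝ) / Lξ) = C * ((C * j) / Lξ) by ring]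
      refine mul_le_mul_of_nonneg_left ?_ hC.le
      rw [div_le_div_iff₀ hLj0 hLξ0]
      nlinarith
    exact h2.trans this
  have hξlow : c ^ 2 * ((j : ℝ) / Lξ) ≤ ξ := by
    have : c ^ 2 * ((j : ℝ) / Lξ) ≤ c * ((j : ℝ) / Lj) := by
      rw [show c ^ 2 * ((j : ℝ) / Lξ) = c * ((c * j) / Lξ) by ring]
      refine mul_le_mul_of_nonneg_left ?_ hc.le
      rw [div_le_div_iff₀ hLξ0 hLj0]
      nlinarith
    exact this.trans h1
  -- `log₊² ξ_j ≤ 23 C² j`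
  have hLξsq : Lξ ^ 2 ≤ 23 * C ^ 2 * j := by
    have hLj2 := logPlus_sq_le_mul hj1
    have : Lξ ^ 2 ≤ (C * Lj) ^ 2 := pow_le_pow_left₀ hLξ0.le h4 2
    nlinarith [sq_nonneg C]
  have hLξle : Lξ ≤ 23 * C ^ 2 * ((j : ℝ) / Lξ) := by
    rw [mul_div_assoc', le_div_iff₀ hLξ0]
    calc Lξ * Lξ = Lξ ^ 2 := by ring
      _ ≤ 23 * C ^ 2 * j := hLξsq
  obtain ⟨hb1, hb2⟩ := abs_sub_le_iff.1 hb
  have hBL : B * Lξ ≤ B' * Lξ := mul_le_mul_of_nonneg_right hBB' hLξ0.le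
  constructor
  · -- lower bound
    rcases le_or_gt j₁ (j : ℝ) with hjbig | hjsmall
    · have hj2 : (2 : ℝ) ≤ j := hj₁2.trans hjbig
      have hsqrt : 46 * B' * C ^ 2 / c ^ 2 ≤ Real.sqrt j := by
        have hnn : 0 ≤ 46 * B' * C ^ 2 / c ^ 2 := by positivity
        have : (46 * B' * C ^ 2 / c ^ 2) ^ 2 ≤ j := by rw [hj₁] at hjbig; linarith
        calc 46 * B' * C ^ 2 / c ^ 2 = Real.sqrt ((46 * B' * C ^ 2 / c ^ 2) ^ 2) := by
              rw [Real.sqrt_sq hnn]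
          _ ≤ Real.sqrt j := Real.sqrt_le_sqrt this
      have hsj : 0 < Real.sqrt j := Real.sqrt_pos.2 hj0
      have hss : Real.sqrt j * Real.sqrt j = j := Real.mul_self_sqrt hj0.le
      -- B' Lξ² ≤ (c²/2) j
      have hLξsq' : Lξ ^ 2 ≤ C ^ 2 * (23 * Real.sqrt j) := by
        have := logPlus_sq_le_sqrt hj2
        have h' : Lξ ^ 2 ≤ (C * Lj) ^ 2 := pow_le_pow_left₀ hLξ0.le h4 2
        nlinarith [sq_nonneg C]
      have hkey : B' * Lξ ^ 2 ≤ c ^ 2 / 2 * j := by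
        have e1 : 46 * B' * C ^ 2 ≤ c ^ 2 * Real.sqrt j := by
          have := mul_le_mul_of_nonneg_left hsqrt (le_of_lt (pow_pos hc 2))
          rwa [mul_div_cancel₀ _ (pow_pos hc 2).ne'] at this
        calc B' * Lξ ^ 2 ≤ B' * (C ^ 2 * (23 * Real.sqrt j)) :=
              mul_le_mul_of_nonneg_left hLξsq' hB'0
          _ = (46 * B' * C ^ 2) * Real.sqrt j / 2 := by ring
          _ ≤ (c ^ 2 * Real.sqrt j) * Real.sqrt j / 2 := by gcongr
          _ = c ^ 2 / 2 * j := by rw [mul_assoc, hss]; ring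
      have hBLξ : B' * Lξ ≤ c ^ 2 / 2 * ((j : ℝ) / Lξ) := by
        rw [mul_div_assoc', le_div_iff₀ hLξ0]
        calc B' * Lξ * Lξ = B' * Lξ ^ 2 := by ring
          _ ≤ c ^ 2 / 2 * j := hkey
      calc min (c ^ 2 / 2) (x₀ * Real.log 2 / j₁) * ((j : ℝ) / Lξ)
          ≤ c ^ 2 / 2 * ((j : ℝ) / Lξ) := mul_le_mul_of_nonneg_right (min_le_left _ _) hq0.le
        _ = c ^ 2 * ((j : ℝ) / Lξ) - c ^ 2 / 2 * ((j : ℝ) / Lξ) := by ring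
        _ ≤ ξ - B' * Lξ := by linarith
        _ ≤ X := by linarith
    · -- small j: x_j ≥ x_1 ≥ x₀
      have hjle : (j : ℝ) / Lξ ≤ j₁ / Real.log 2 := by
        rw [div_le_div_iff₀ hLξ0 hlog2]; nlinarith
      calc min (c ^ 2 / 2) (x₀ * Real.log 2 / j₁) * ((j : ℝ) / Lξ)
          ≤ x₀ * Real.log 2 / j₁ * ((j : ℝ) / Lξ) :=
            mul_le_mul_of_nonneg_right (min_le_right _ _) hq0.le
        _ ≤ x₀ * Real.log 2 / j₁ * (j₁ / Real.log 2) :=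
            mul_le_mul_of_nonneg_left hjle hsmallc.le
        _ = x₀ := by field_simp
        _ ≤ X := hmono
  · -- upper bound
    calc X ≤ ξ + B * Lξ := by linarith
      _ ≤ C ^ 2 * ((j : ℝ) / Lξ) + B' * (23 * C ^ 2 * ((j : ℝ) / Lξ)) := by
          have := mul_le_mul_of_nonneg_left hLξle hB'0
          linarith
      _ = (C ^ 2 + 23 * B' * C ^ 2) * ((j : ℝ) / Lξ) := by ring

/-- **Corollary 3.3, eq. (51) — RH-FREE, over the kernel theorems, uniformly on `[−T₀, 0]`.** For
every `T₀` there are `0 < c ≤ C` such that for every `t ∈ [−T₀, 0]` above a real-rooted time and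
every `j ≥ 1`, `c·j/log₊ ξ_j ≤ x_j(t) ≤ C·j/log₊ ξ_j`: the location law (50) with one constant on
the interval (`cor33_location_inner`, from Theorem 3.2 (48) `thm32_bigO_inner`) and the uniform
floor `x₀ ≤ x_1(t)` (`RodgersTaoOrderUniform.exists_pos_le_deBruijnZero`) fed into
`cor33_order_of_location_uniform`. (The second comparison `j/log₊ ξ_j ≍ j/log₊ j` of (51) is
`t`-free: `lemma31_i_order_holds`.) [cite: RodgersTaoFMP2020, Corollary 3.3 = Corollary 10 eq. (51) p.23] -/
theorem cor33_order_inner (T₀ : ℝ) :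
    ∃ c C : ℝ, 0 < c ∧ c ≤ C ∧
      ∀ t ∈ Icc (-T₀) 0, (∃ t₁ : ℝ, t₁ < t ∧ HasOnlyRealZeros (deBruijnH t₁)) →
        ∀ j : ℕ, 1 ≤ j →
          c * ((j : ℝ) / logPlus (classicalLocation (j : ℝ))) ≤ deBruijnZero t j ∧
            deBruijnZero t j ≤ C * ((j : ℝ) / logPlus (classicalLocation (j : ℝ))) := by
  obtain ⟨B, hB⟩ := cor33_location_inner T₀
  obtain ⟨x₀, hx₀, hx⟩ := RodgersTaoOrderUniform.exists_pos_le_deBruijnZero T₀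
  obtain ⟨c, C, hc, hcC, h⟩ := cor33_order_of_location_uniform B hx₀
  exact ⟨c, C, hc, hcC, fun t ht hΛ j hj ↦ h t hΛ (hx t ht hΛ 1 le_rfl) (hB t ht hΛ) j hj⟩

/-- **Corollary 3.3 (51) AS PRINTED, WITH CONTENT.** The as-printed named fact `cor33_order`
(absolute `0 < c ≤ C`, uniform over all `t` above a real-rooted time with `t ≤ 0`,
`c·j/log₊ ξ_j ≤ x_j(t) ≤ C·j/log₊ ξ_j` for `j ≥ 1`) — so far in the tree only EX FALSO
(`cor33_order_holds`, from `Λ ≥ 0`) — proved along the printed route: the real-rooted times are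
bounded below (Newman 1976, `bddBelow_setOf_hasOnlyRealZeros_holds`), so every admissible `t`
lies in one window `[L, 0]`, where `cor33_order_inner` applies. No use of `Λ ≥ 0`.
[cite: RodgersTaoFMP2020, Corollary 3.3 = Corollary 10 eq. (51) p.23] -/
theorem cor33_order_content : cor33_order := by
  obtain ⟨L, hL⟩ := bddBelow_setOf_hasOnlyRealZeros_holds
  obtain ⟨c, C, hc, hcC, h⟩ := cor33_order_inner (-L)
  refine ⟨c, C, hc, hcC, fun t hΛ ht0 j hj ↦ h t ⟨?_, ht0⟩ hΛ j hj⟩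
  obtain ⟨t₁, ht₁, hr⟩ := hΛ
  have := hL hr
  linarith

end RodgersTao2020

end Literature.NumberTheory.LFunctions
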